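import Mathlib
import HarnessLib

/-!
# Amplified critical window — stub A, sub-helper (c₁): the recursive-majority bias sequence
(cell pnp-ideate, rung F-N1/p3, ROUND-11; line `amplified-window` on item stmt-PneNP-19860, stub A
`MonotoneAmplification`; card HOME/pnp-ideate-p3/r11/amplified-window.md §6 (c))

O'Donnell's expected-bias recursion for the recursive majority of three: if the three subtrees of
`RM3_{d+1}` carry independent, sign-symmetric random biases with second moment `q`, the root bias
`(b₁+b₂+b₃ − b₁b₂b₃)/2` has second moment `(3q + q³)/4`.  This file is the pure real-sequence part:

* `biasSeq η d`: `q_0 = 1 − η`, `q_{d+1} = (3 q_d + q_d³)/4`;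
* `biasSeq_mem` — `q_d ∈ [0,1]` for `η ∈ [0,1]`; `biasSeq_succ_le` — nonincreasing;
* `one_sub_biasSeq_succ` — `1 − q_{d+1} = (1 − q_d)(q_d² + q_d + 4)/4`, hence growth by `≥ 19/16` per
  level while `q_d ≥ 1/2` (`one_sub_biasSeq_succ_ge`); `biasSeq_succ_le_of_le_half` — `q_{d+1} ≤ (13/16) q_d`
  once `q_d ≤ 1/2`;
* `biasSeq_decay` — for `0 < η ≤ 1` there is `C(η) > 0` with `q_d ≤ C·(13/16)^d` for all `d`
  (so `E|bias(RM3_d)| ≤ √q_d ≤ √C · (3^d)^{−α}`, `α = log₃(16/13)/2`, in the amplification stub).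

[R. O'Donnell, *Hardness amplification within NP*, JCSS 69 (2004), §3 (expected bias of recursive
majority); cell record ROUND-11 §B.1 (A)]

HONEST FRAMING: elementary real analysis for the OPEN stub A; nothing here bears on P vs NP.
-/

set_option linter.dupNamespace false -- `Summit.PneNP.PneNP.…`: summit = sub-problem name (D-0017 single-conjunct layout)

namespace Summit.PneNP.PneNP.Theorems.NegLimitedAmplifiedWindow

/-- The RM3 bias second-moment sequence: `q_0 = 1 − η`, `q_{d+1} = (3 q_d + q_d³)/4`. -/
noncomputable def biasSeq (η : ℝ) : ℕ → ℝ
  | 0 => 1 - η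
  | d + 1 => (3 * biasSeq η d + biasSeq η d ^ 3) / 4

/-- `q_0 = 1 − η`. -/
theorem biasSeq_zero (η : ℝ) : biasSeq η 0 = 1 - η := rfl

/-- The recursion `q_{d+1} = (3 q_d + q_d³)/4`. -/
theorem biasSeq_succ (η : ℝ) (d : ℕ) : biasSeq η (d + 1) = (3 * biasSeq η d + biasSeq η d ^ 3) / 4 := rfl

/-- `q_d ∈ [0, 1]` for `η ∈ [0, 1]`. -/
theorem biasSeq_mem {η : ℝ} (hη0 : 0 ≤ η) (hη1 : η ≤ 1) : ∀ d, 0 ≤ biasSeq η d ∧ biasSeq η d ≤ 1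
  | 0 => by rw [biasSeq_zero]; constructor <;> linarith
  | d + 1 => by
    obtain ⟨h0, h1⟩ := biasSeq_mem hη0 hη1 d
    rw [biasSeq_succ]
    have h3 : biasSeq η d ^ 3 ≤ 1 := pow_le_one₀ h0 h1
    constructor
    · positivity
    · linarith

/-- `1 − q_{d+1} = (1 − q_d)(q_d² + q_d + 4)/4`. -/
theorem one_sub_biasSeq_succ (η : ℝ) (d : ℕ) :
    1 - biasSeq η (d + 1) = (1 - biasSeq η d) * (biasSeq η d ^ 2 + biasSeq η d + 4) / 4 := by
  rw [biasSeq_succ]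
  ring

/-- The sequence is nonincreasing (for `η ∈ [0,1]`). -/
theorem biasSeq_succ_le {η : ℝ} (hη0 : 0 ≤ η) (hη1 : η ≤ 1) (d : ℕ) : biasSeq η (d + 1) ≤ biasSeq η d := by
  obtain ⟨h0, h1⟩ := biasSeq_mem hη0 hη1 d
  rw [biasSeq_succ]
  have : biasSeq η d ^ 3 ≤ biasSeq η d := by
    calc biasSeq η d ^ 3 = biasSeq η d * biasSeq η d ^ 2 := by ring
      _ ≤ biasSeq η d * 1 := mul_le_mul_of_nonneg_left (pow_le_one₀ h0 h1) h0
      _ = biasSeq η d := mul_one _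
  linarith

/-- Phase 1: while `q_d ≥ 1/2`, the gap to `1` grows by a factor `≥ 19/16`. -/
theorem one_sub_biasSeq_succ_ge {η : ℝ} (hη0 : 0 ≤ η) (hη1 : η ≤ 1) {d : ℕ} (hd : 1 / 2 ≤ biasSeq η d) :
    19 / 16 * (1 - biasSeq η d) ≤ 1 - biasSeq η (d + 1) := by
  obtain ⟨_, h1⟩ := biasSeq_mem hη0 hη1 d
  rw [one_sub_biasSeq_succ]
  have hq : 19 / 4 ≤ biasSeq η d ^ 2 + biasSeq η d + 4 := by nlinarith
  nlinarith

/-- Phase 2: once `q_d ≤ 1/2`, `q_{d+1} ≤ (13/16) q_d`. -/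
theorem biasSeq_succ_le_of_le_half {η : ℝ} (hη0 : 0 ≤ η) (hη1 : η ≤ 1) {d : ℕ} (hd : biasSeq η d ≤ 1 / 2) :
    biasSeq η (d + 1) ≤ 13 / 16 * biasSeq η d := by
  obtain ⟨h0, _⟩ := biasSeq_mem hη0 hη1 d
  rw [biasSeq_succ]
  have : biasSeq η d ^ 3 ≤ 1 / 4 * biasSeq η d := by
    have hsq : biasSeq η d ^ 2 ≤ 1 / 4 := by nlinarith
    calc biasSeq η d ^ 3 = biasSeq η d ^ 2 * biasSeq η d := by ring
      _ ≤ 1 / 4 * biasSeq η d := mul_le_mul_of_nonneg_right hsq h0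
  linarith

/-- Once below `1/2`, the sequence stays below `1/2`. -/
theorem biasSeq_le_half_of_le {η : ℝ} (hη0 : 0 ≤ η) (hη1 : η ≤ 1) {j : ℕ} (hj : biasSeq η j ≤ 1 / 2) :
    ∀ d, j ≤ d → biasSeq η d ≤ 1 / 2 := by
  intro d hjd
  induction d with
  | zero =>
    have : j = 0 := by omega
    subst this; exact hj
  | succ d ih =>
    rcases Nat.eq_or_lt_of_le hjd with h | h
    · rw [← h]; exact hj
    · exact (biasSeq_succ_le hη0 hη1 d).trans (ih (by omega))

/-- Phase 1 reaches `1/2`: some `j₀` has `q_{j₀} ≤ 1/2` (for `0 < η ≤ 1`). -/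
theorem exists_biasSeq_le_half {η : ℝ} (hη : 0 < η) (hη1 : η ≤ 1) : ∃ j, biasSeq η j ≤ 1 / 2 := by
  -- pick `j₀` with `(19/16)^{j₀} η ≥ 1/2`
  obtain ⟨j₀, hj₀⟩ := pow_unbounded_of_one_lt (1 / (2 * η)) (by norm_num : (1 : ℝ) < 19 / 16)
  -- dichotomy along the way
  have key : ∀ j, biasSeq η j ≤ 1 / 2 ∨ (19 / 16 : ℝ) ^ j * η ≤ 1 - biasSeq η j := by
    intro j
    induction j with
    | zero => right; rw [biasSeq_zero, pow_zero, one_mul]; linarith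
    | succ j ih =>
      rcases ih with h | h
      · left
        exact (biasSeq_succ_le hη.le hη1 j).trans h
      · by_cases hq : biasSeq η j ≤ 1 / 2
        · left; exact (biasSeq_succ_le hη.le hη1 j).trans hq
        · right
          have hge := one_sub_biasSeq_succ_ge hη.le hη1 (not_le.mp hq).le
          calc (19 / 16 : ℝ) ^ (j + 1) * η = 19 / 16 * ((19 / 16) ^ j * η) := by ring
            _ ≤ 19 / 16 * (1 - biasSeq η j) := by nlinarith
            _ ≤ 1 - biasSeq η (j + 1) := hge
  rcases key j₀ with h | h
  · exact ⟨j₀, h⟩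
  · refine ⟨j₀, ?_⟩
    have : 1 / 2 ≤ (19 / 16 : ℝ) ^ j₀ * η := by
      have h2 : 1 / (2 * η) * η = 1 / 2 := by field_simp
      nlinarith [hj₀.le]
    linarith

/-- **Geometric decay**: for `0 < η ≤ 1` there is `C(η) > 0` with `q_d ≤ C·(13/16)^d` for all `d`. -/
theorem biasSeq_decay {η : ℝ} (hη : 0 < η) (hη1 : η ≤ 1) :
    ∃ C : ℝ, 0 < C ∧ ∀ d, biasSeq η d ≤ C * (13 / 16) ^ d := by
  obtain ⟨j₀, hj₀⟩ := exists_biasSeq_le_half hη hη1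
  refine ⟨(16 / 13) ^ j₀, by positivity, fun d => ?_⟩
  rcases le_or_gt j₀ d with hd | hd
  · -- geometric phase
    have hgeo : ∀ m, biasSeq η (j₀ + m) ≤ (13 / 16) ^ m * (1 / 2) := by
      intro m
      induction m with
      | zero => simpa using hj₀
      | succ m ih =>
        have hhalf : biasSeq η (j₀ + m) ≤ 1 / 2 := biasSeq_le_half_of_le hη.le hη1 hj₀ _ (by omega)
        calc biasSeq η (j₀ + (m + 1)) = biasSeq η (j₀ + m + 1) := by rw [Nat.add_assoc]
          _ ≤ 13 / 16 * biasSeq η (j₀ + m) := biasSeq_succ_le_of_le_half hη.le hη1 hhalf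
          _ ≤ 13 / 16 * ((13 / 16) ^ m * (1 / 2)) := by nlinarith
          _ = (13 / 16) ^ (m + 1) * (1 / 2) := by ring
    obtain ⟨m, rfl⟩ := Nat.exists_eq_add_of_le hd
    calc biasSeq η (j₀ + m) ≤ (13 / 16) ^ m * (1 / 2) := hgeo m
      _ ≤ (13 / 16 : ℝ) ^ m := by
          have : (0 : ℝ) ≤ (13 / 16) ^ m := by positivity
          linarith
      _ = (16 / 13) ^ j₀ * (13 / 16) ^ (j₀ + m) := by
          rw [pow_add, ← mul_assoc, ← mul_pow]; norm_num
  · -- early phase: `q_d ≤ 1 ≤ (16/13)^{j₀ - d}`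
    have h1 : biasSeq η d ≤ 1 := (biasSeq_mem hη.le hη1 d).2
    obtain ⟨m, rfl⟩ := Nat.exists_eq_add_of_le hd.le
    calc biasSeq η d ≤ 1 := h1
      _ ≤ (16 / 13 : ℝ) ^ m := one_le_pow₀ (by norm_num)
      _ = (16 / 13) ^ (d + m) * (13 / 16) ^ d := by
          rw [pow_add, mul_comm ((16 / 13 : ℝ) ^ d), mul_assoc, ← mul_pow]; norm_num

end Summit.PneNP.PneNP.Theorems.NegLimitedAmplifiedWindow
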